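import Literature.Topology.FourManifolds.TrisectionFunctorGK
import Mathlib.Tactic.Group
import HarnessLib

/-!
# Stabilisation compatibility of the Abrams–Gay–Kirby functor: the algebraic layer of fact (c′)

Topic `Literature/Topology/FourManifolds`; sibling of `TrisectionFunctorGK.lean` (fact seat
`provefact-Literature.Topology.FourManifolds.exists-14560f9fc8`, named fact (c′)
`Literature.Topology.FourManifolds.exists_stabilized_gkTrisection`: a balanced Gay–Kirby
`(g, k)`-trisection of a closed connected oriented smooth `X`, with ANY base point `x₀` on the
central surface `F` and ANY marking `μ : S_g ≃* π₁(F, x₀)`, can be stabilised to a balanced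
`(g+3, k+1)`-trisection of `X` whose kernel triple is isomorphic to the algebraic stabilisation
`TrisectionKernels.stabilize` of `𝒢(h, x₀, μ)` — Gay–Kirby 2016, Def. 8 and Lemma 10;
Abrams–Gay–Kirby 2018, Def. 3 and Thm. 5).

## Status of (c′) and what this file does

(c′) is NOT discharged here and stays a named fact.  Its printed proof has two halves.

* **Geometric half** (Gay–Kirby, Def. 8 / Lemma 10, arXiv pp. 4 and 15; Abrams–Gay–Kirby, proof of
  Thm. 5, p. 1542: "The connected sum operation and the `(3,1)`-trisection on the group side are
  constructed exactly to correspond to stabilization of manifolds via the map `ℳ`"): drill a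
  boundary-parallel arc out of each handlebody `H_{ij}`, give its regular neighbourhood to the
  opposite sector, and check that the three new pieces are again `1`-handlebodies (genus `k + 1`)
  meeting in genus-`(g+3)` handlebodies along `F′ = F # Σ₃`; by Seifert–van Kampen the new kernel
  triple, read through a marking `μ′` extending a *geometric* marking `μ₀` of `F` (one induced by a
  free basis of `π₁(F ∖ disc)` in which the boundary circle is the surface relator), is the
  algebraic stabilisation of `𝒢(h, x₀, μ₀)` on the nose.  Over the tree's predicate
  `IsBalancedGKTrisection` (corner charts along `F`, Morse-theoretic handle counts,
  `Trisections.lean`/`Handles.lean`) this needs tubular neighbourhoods of arcs meeting the corner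
  stratum, handle attachment with exact critical-point counts, and van Kampen with amalgamation —
  none of which is in Mathlib or in the tree (the genus-`0` trisection of the round `S⁴` alone,
  `SphereTrisectionsSectors.lean`, takes ~3000 lines).  It enters below only as a hypothesis.
* **Algebraic half.**  (c′) quantifies over ALL markings `μ`, whereas the geometry computes the
  kernels for ONE marking `μ₀`; the two differ by the automorphism `α = μ⁻¹ ∘ μ₀` of `S_g`
  (`groupGKTrisectionOf_eq_map_of_markings`: `𝒢(h, x₀, μ) = α(𝒢(h, x₀, μ₀))` on the nose), so one
  needs `Iso (K.stabilize) ((α K).stabilize)` — "stabilisation is well defined on isomorphism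
  classes of group trisections" (Abrams–Gay–Kirby, Def. 2–3 define the connected sum generator-wise
  and use it on classes in Thm. 5).  Since `TrisectionKernels.stabilize` is defined through lifts
  to the free group `F⟨a₁, …, b_g⟩` (`genIncl`), this holds for every `α` that is induced by an
  automorphism `φ` of the free group with `φ(r_g)` a conjugate of `r_g^{±1}` — and by **Nielsen's
  theorem** ("if `G = (X; r)` is the canonical presentation of the fundamental group of a closed
  2-manifold … every automorphism of `G` is induced by an automorphism of `F`", Lyndon–Schupp,
  Ch. I §4, last remark, and Ch. II §2) together with **Magnus' conjugacy theorem** (same normal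
  closure ⇒ conjugate to `r` or `r⁻¹`, Lyndon–Schupp Prop. II.5.8) every `α` is of this kind.
  Nielsen's theorem is not in Mathlib or the tree either; it enters as a hypothesis.

What is PROVED here, sorry-free and without new definitions or named facts:

* `exists_freeGroup_mulEquiv_extension` — automorphisms `φ` of `F⟨a₁,…,b_g⟩` and `τ` of
  `F⟨a₁,…,b₃⟩` extend to an automorphism of `F⟨a₁,…,b_{g+3}⟩` (`E ∘ ι = ι ∘ φ`, `E ∘ σ = σ ∘ τ`),
  with `E(r_{g+3}) = ι(φ r_g) · σ(τ r₃)` (`freeGroup_extension_surfaceRelator`);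
* `exists_flip_freeGroup_three` — an explicit involution `θ` of `F⟨a₁,…,b₃⟩` with
  `θ(r₃) = r₃⁻¹` on the nose sending each generator to a conjugate of itself or its inverse (an
  algebraic orientation reversal of `Σ₃` fixing the three `S⁴` cut systems), used to absorb the
  sign `ε = -1`;
* `exists_surfaceGroup_mulEquiv_of_free` — such an `E` descends to an automorphism of `S_{g+3}`;
* `TrisectionKernels.stabilize_map_conj` — inner automorphisms of `S_g` do not change the
  stabilised triple (`stabilize (d K d⁻¹) = stabilize K`);
* `TrisectionKernels.iso_stabilize_map_of_lift`, `TrisectionKernels.Iso.stabilize_of_lift` — **the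
  algebraic half**: for `α` liftable in the above sense, `Iso K.stabilize (α K).stabilize`;
* `liftable_refl`, `liftable_conj`, `liftable_trans`, `liftable_symm` — liftable automorphisms
  form a subgroup of `Aut S_g` containing the inner automorphisms (so a proof of Nielsen's theorem
  may proceed by generators);
* `exists_stabilized_gkTrisection_of_lift` — **(c′) for one marked trisection** from its geometric
  stabilisation for some marking `μ₀` and a Nielsen lift of `μ⁻¹ ∘ μ₀`;
* `exists_stabilized_gkTrisection_of_geometric_of_nielsen` — **the shape of a future discharge**:
  (c′) follows from the geometric half (for one marking per trisection and base point) and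
  Nielsen's theorem (for all `g`).

Nothing here weakens or restates (c′); `exists_stabilized_gkTrisection_holds` is NOT claimed.

## References

* A. Abrams, D. Gay, R. Kirby, *Group trisections and smooth 4-manifolds*, Geom. Topol. 22 (2018)
  1537–1545 (arXiv:1605.06731): Def. 1–3 (pp. 1538–1540; arXiv p. 2: "The stabilization of a group
  trisection is the connected sum of the given trisection with the standard trivial
  `(3,1)`-trisection"), Fig. 1–2 (the standard trivial `(3,1)`-trisection, kernels
  `⟪a₁,a₂,b₃⟫, ⟪a₁,b₂,a₃⟫, ⟪b₁,a₂,a₃⟫`), Thm. 5 (p. 1541; arXiv p. 4: "connected sums of group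
  trisections map to connected sums of 4-manifold trisections") and its proof (p. 1542; arXiv
  p. 6). [AbramsGayKirby2018]
* D. Gay, R. Kirby, *Trisecting 4-manifolds*, Geom. Topol. 20 (2016) 3097–3132 (arXiv:1205.1565):
  Def. 8 (stabilisation), Def. 9, Lemma 10 (arXiv p. 4) and its proof (arXiv p. 15). [GayKirby2016]
* R. C. Lyndon, P. E. Schupp, *Combinatorial Group Theory*, Springer (1977/2001): Ch. I §4, last
  remark (Nielsen: automorphisms of surface groups are induced by free automorphisms), Ch. II §2
  ("Nielsen (1917) showed that … the indicated presentation is almost quasifree"), Prop. II.5.8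
  (Magnus: equal normal closures ⇒ conjugate to `r^{±1}`). [LyndonSchupp2001]
* J. Nielsen, *Untersuchungen zur Topologie der geschlossenen zweiseitigen Flächen*, Acta Math. 50
  (1927) 189–358 (the lifting theorem; not held, cited through Lyndon–Schupp).
-/

noncomputable section

open Set Subgroup
open scoped Manifold ContDiff

namespace Literature.Topology.FourManifolds

universe u

/-! ### Free-group bookkeeping on the generators of genus `g + 3` -/

section FreeLevel

variable {g : ℕ}

/-- Every generator of `F⟨a₁, …, b_{g+3}⟩` is either one of the first `g` handles (image of
`genIncl`) or one of the last three (image of `genShift`). [folklore] -/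
theorem of_eq_genIncl_or_genShift (p : surfaceGen (g + 3)) :
    (∃ q : surfaceGen g, FreeGroup.of p = genIncl g (FreeGroup.of q)) ∨
      (∃ q : surfaceGen 3, FreeGroup.of p = genShift g (FreeGroup.of q)) := by
  obtain ⟨i, b⟩ := p
  induction i using Fin.addCases with
  | left i => exact Or.inl ⟨(i, b), by simp⟩
  | right j => exact Or.inr ⟨(j, b), by simp⟩

/-- Two homomorphisms out of `F⟨a₁, …, b_{g+3}⟩` agreeing on the first `g` handles and on the
last three handles are equal. [folklore] -/
theorem freeGroup_hom_ext_genIncl_genShift {M : Type*} [Monoid M]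
    {E E' : FreeGroup (surfaceGen (g + 3)) →* M}
    (h₁ : E.comp (genIncl g) = E'.comp (genIncl g)) (h₂ : E.comp (genShift g) = E'.comp (genShift g)) :
    E = E' := by
  refine FreeGroup.ext_hom _ _ fun p => ?_
  rcases of_eq_genIncl_or_genShift p with ⟨q, hq⟩ | ⟨q, hq⟩
  · rw [hq]
    exact DFunLike.congr_fun h₁ (FreeGroup.of q)
  · rw [hq]
    exact DFunLike.congr_fun h₂ (FreeGroup.of q)

/-- **Free extension.**  Endomorphisms `φ` of `F⟨a₁, …, b_g⟩` and `τ` of `F⟨a₁, …, b₃⟩` extend to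
an endomorphism `E` of `F⟨a₁, …, b_{g+3}⟩` acting by `φ` on the first `g` handles and by `τ` on the
last three (`E ∘ ι = ι ∘ φ`, `E ∘ σ = σ ∘ τ`). [folklore] -/
theorem exists_freeGroup_extension (φ : FreeGroup (surfaceGen g) →* FreeGroup (surfaceGen g))
    (τ : FreeGroup (surfaceGen 3) →* FreeGroup (surfaceGen 3)) :
    ∃ E : FreeGroup (surfaceGen (g + 3)) →* FreeGroup (surfaceGen (g + 3)),
      E.comp (genIncl g) = (genIncl g).comp φ ∧ E.comp (genShift g) = (genShift g).comp τ := by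
  refine ⟨FreeGroup.lift fun p => Fin.addCases (motive := fun _ => FreeGroup (surfaceGen (g + 3)))
      (fun i => genIncl g (φ (FreeGroup.of (i, p.2))))
      (fun j => genShift g (τ (FreeGroup.of (j, p.2)))) p.1, ?_, ?_⟩
  · exact FreeGroup.ext_hom _ _ fun q => by simp
  · exact FreeGroup.ext_hom _ _ fun q => by simp

/-- Extensions compose: if `E` extends `(φ, τ)` and `E'` extends `(φ', τ')` then `E' ∘ E` extends
`(φ' ∘ φ, τ' ∘ τ)`. [folklore] -/
theorem freeGroup_extension_comp {φ φ' : FreeGroup (surfaceGen g) →* FreeGroup (surfaceGen g)}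
    {τ τ' : FreeGroup (surfaceGen 3) →* FreeGroup (surfaceGen 3)}
    {E E' : FreeGroup (surfaceGen (g + 3)) →* FreeGroup (surfaceGen (g + 3))}
    (hE₁ : E.comp (genIncl g) = (genIncl g).comp φ) (hE₂ : E.comp (genShift g) = (genShift g).comp τ)
    (hE'₁ : E'.comp (genIncl g) = (genIncl g).comp φ')
    (hE'₂ : E'.comp (genShift g) = (genShift g).comp τ') :
    (E'.comp E).comp (genIncl g) = (genIncl g).comp (φ'.comp φ) ∧
      (E'.comp E).comp (genShift g) = (genShift g).comp (τ'.comp τ) := by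
  constructor
  · rw [MonoidHom.comp_assoc, hE₁, ← MonoidHom.comp_assoc, hE'₁, MonoidHom.comp_assoc]
  · rw [MonoidHom.comp_assoc, hE₂, ← MonoidHom.comp_assoc, hE'₂, MonoidHom.comp_assoc]

/-- **Free extension of automorphisms.**  Automorphisms `φ` of `F⟨a₁, …, b_g⟩` and `τ` of
`F⟨a₁, …, b₃⟩` extend to an automorphism of `F⟨a₁, …, b_{g+3}⟩` acting by `φ` on the first `g`
handles and by `τ` on the last three. [folklore] -/
theorem exists_freeGroup_mulEquiv_extension
    (φ : FreeGroup (surfaceGen g) ≃* FreeGroup (surfaceGen g))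
    (τ : FreeGroup (surfaceGen 3) ≃* FreeGroup (surfaceGen 3)) :
    ∃ E : FreeGroup (surfaceGen (g + 3)) ≃* FreeGroup (surfaceGen (g + 3)),
      E.toMonoidHom.comp (genIncl g) = (genIncl g).comp φ.toMonoidHom ∧
        E.toMonoidHom.comp (genShift g) = (genShift g).comp τ.toMonoidHom := by
  obtain ⟨E, hE₁, hE₂⟩ := exists_freeGroup_extension (g := g) φ.toMonoidHom τ.toMonoidHom
  obtain ⟨E', hE'₁, hE'₂⟩ := exists_freeGroup_extension (g := g) φ.symm.toMonoidHom τ.symm.toMonoidHom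
  have hφ : φ.symm.toMonoidHom.comp φ.toMonoidHom = MonoidHom.id _ :=
    MonoidHom.ext fun x => φ.symm_apply_apply x
  have hφ' : φ.toMonoidHom.comp φ.symm.toMonoidHom = MonoidHom.id _ :=
    MonoidHom.ext fun x => φ.apply_symm_apply x
  have hτ : τ.symm.toMonoidHom.comp τ.toMonoidHom = MonoidHom.id _ :=
    MonoidHom.ext fun x => τ.symm_apply_apply x
  have hτ' : τ.toMonoidHom.comp τ.symm.toMonoidHom = MonoidHom.id _ :=
    MonoidHom.ext fun x => τ.apply_symm_apply x
  have h1 : E'.comp E = MonoidHom.id _ := by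
    obtain ⟨h₁, h₂⟩ := freeGroup_extension_comp hE₁ hE₂ hE'₁ hE'₂
    rw [hφ] at h₁
    rw [hτ] at h₂
    exact freeGroup_hom_ext_genIncl_genShift (by rw [h₁]; rfl) (by rw [h₂]; rfl)
  have h2 : E.comp E' = MonoidHom.id _ := by
    obtain ⟨h₁, h₂⟩ := freeGroup_extension_comp hE'₁ hE'₂ hE₁ hE₂
    rw [hφ'] at h₁
    rw [hτ'] at h₂
    exact freeGroup_hom_ext_genIncl_genShift (by rw [h₁]; rfl) (by rw [h₂]; rfl)
  exact ⟨MonoidHom.toMulEquiv E E' h1 h2, hE₁, hE₂⟩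

/-- An extension `E` of `(φ, τ)` maps the surface relator of genus `g + 3` to
`ι(φ r_g) · σ(τ r₃)` (`r_{g+3} = ι(r_g) · σ(r₃)`, `surfaceRelator_add_three`). [folklore] -/
theorem freeGroup_extension_surfaceRelator {φ : FreeGroup (surfaceGen g) →* FreeGroup (surfaceGen g)}
    {τ : FreeGroup (surfaceGen 3) →* FreeGroup (surfaceGen 3)}
    {E : FreeGroup (surfaceGen (g + 3)) →* FreeGroup (surfaceGen (g + 3))}
    (hE₁ : E.comp (genIncl g) = (genIncl g).comp φ) (hE₂ : E.comp (genShift g) = (genShift g).comp τ) :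
    E (surfaceRelator (g + 3)) = genIncl g (φ (surfaceRelator g)) * genShift g (τ (surfaceRelator 3)) := by
  rw [surfaceRelator_add_three, map_mul]
  exact congrArg₂ (· * ·) (DFunLike.congr_fun hE₁ (surfaceRelator g))
    (DFunLike.congr_fun hE₂ (surfaceRelator 3))

end FreeLevel

/-! ### Normal closures -/

section NormalClosure

variable {G : Type*} [Group G]

/-- A conjugate of `x^{±1}` has the same normal closure as `x`. [folklore] -/
theorem normalClosure_singleton_eq_of_eq_conj_zpow {x y c : G} {ε : ℤ} (hε : ε = 1 ∨ ε = -1)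
    (h : y = c * x ^ ε * c⁻¹) : normalClosure ({y} : Set G) = normalClosure {x} := by
  apply le_antisymm
  · refine normalClosure_le_normal ?_
    intro a ha
    rw [Set.mem_singleton_iff] at ha
    rw [SetLike.mem_coe, ha, h]
    exact Subgroup.normalClosure_normal.conj_mem _
      (zpow_mem (subset_normalClosure (Set.mem_singleton x)) ε) c
  · refine normalClosure_le_normal ?_
    intro a ha
    rw [Set.mem_singleton_iff] at ha
    have hx : x = c⁻¹ * y ^ ε * c⁻¹⁻¹ := by
      rw [h]
      rcases hε with rfl | rfl <;> group
    rw [SetLike.mem_coe, ha, hx]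
    exact Subgroup.normalClosure_normal.conj_mem _
      (zpow_mem (subset_normalClosure (Set.mem_singleton y)) ε) c⁻¹

/-- Conjugating part of a generating set does not change the normal closure:
`⟪D A D⁻¹ ∪ B⟫ = ⟪A ∪ B⟫`. [folklore] -/
theorem normalClosure_conj_image_union (D : G) (A B : Set G) :
    normalClosure ((fun a => D * a * D⁻¹) '' A ∪ B) = normalClosure (A ∪ B) := by
  apply le_antisymm
  · refine normalClosure_le_normal ?_
    rintro x (⟨a, ha, rfl⟩ | hx)
    · exact Subgroup.normalClosure_normal.conj_mem _
        (subset_normalClosure (Set.mem_union_left B ha)) D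
    · exact subset_normalClosure (Set.mem_union_right _ hx)
  · refine normalClosure_le_normal ?_
    rintro x (hx | hx)
    · have : x = D⁻¹ * (D * x * D⁻¹) * D⁻¹⁻¹ := by group
      rw [this]
      exact Subgroup.normalClosure_normal.conj_mem _
        (subset_normalClosure (Set.mem_union_left B
          (Set.mem_image_of_mem (fun a => D * a * D⁻¹) hx))) D⁻¹
    · exact subset_normalClosure (Set.mem_union_right _ hx)

end NormalClosure

/-! ### Descending free automorphisms to the surface group -/

section Descent

variable {n : ℕ}

/-- The kernel of `F⟨a₁, …, b_n⟩ ↠ S_n` is the normal closure of the surface relator. [folklore] -/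
theorem ker_presentedGroup_mk_surface :
    (PresentedGroup.mk ({surfaceRelator n} : Set (FreeGroup (surfaceGen n)))).ker =
      normalClosure {surfaceRelator n} := by
  ext x
  rw [MonoidHom.mem_ker, PresentedGroup.mk_eq_one_iff]

/-- **Descent.**  An automorphism `E` of the free group whose value on the surface relator has
the same normal closure as the relator (e.g. a conjugate of `r^{±1}`) induces an automorphism
`β` of the surface group with `β [x] = [E x]`. [folklore] -/
theorem exists_surfaceGroup_mulEquiv_of_free
    (E : FreeGroup (surfaceGen n) ≃* FreeGroup (surfaceGen n))
    (hE : normalClosure ({E (surfaceRelator n)} : Set (FreeGroup (surfaceGen n))) =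
      normalClosure {surfaceRelator n}) :
    ∃ β : SurfaceGroup n ≃* SurfaceGroup n,
      ∀ x, β (PresentedGroup.mk _ x) = PresentedGroup.mk _ (E x) := by
  have he : (normalClosure ({surfaceRelator n} : Set (FreeGroup (surfaceGen n)))).map
      E.toMonoidHom = normalClosure {surfaceRelator n} := by
    rw [map_normalClosure _ _ E.surjective]
    simpa using hE
  exact ⟨QuotientGroup.congr _ _ E he, fun x => rfl⟩

end Descent

/-! ### The orientation flip of the genus-`3` surface group -/

section Flip

/-- **An orientation-reversing automorphism of `F⟨a₁, b₁, a₂, b₂, a₃, b₃⟩` adapted to the `S⁴`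
kernels.**  There is an automorphism `θ` of the free group on the genus-`3` generators with
`θ(r₃) = r₃⁻¹` *on the nose* (`r₃ = [a₁,b₁][a₂,b₂][a₃,b₃]`) which sends every generator to a
conjugate of itself or of its inverse (so that it preserves the normal closure of any set of
generators, in particular the lifted `S⁴` kernels `⟪a₁,a₂,b₃⟫, ⟪a₁,b₂,a₃⟫, ⟪b₁,a₂,a₃⟫`), and the
same holds for `θ⁻¹` (indeed `θ` is an involution).  Explicitly, with `cⱼ = [aⱼ, bⱼ]`,
`v₁ = c₃⁻¹c₂⁻¹`, `v₂ = c₃⁻¹`, `v₃ = 1`: `θ(aⱼ) = vⱼ aⱼ⁻¹ vⱼ⁻¹`, `θ(bⱼ) = (vⱼaⱼ) bⱼ (vⱼaⱼ)⁻¹`,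
whence `θ(cⱼ) = vⱼ cⱼ⁻¹ vⱼ⁻¹` and `θ(c₁c₂c₃) = c₃⁻¹c₂⁻¹c₁⁻¹`.  Geometrically: a reflection of
`Σ₃` fixing the base point, composed with the isotopy making it fix each cut curve setwise. [folklore] -/
theorem exists_flip_freeGroup_three :
    ∃ θ : FreeGroup (surfaceGen 3) ≃* FreeGroup (surfaceGen 3),
      θ (surfaceRelator 3) = (surfaceRelator 3)⁻¹ ∧ θ.symm (surfaceRelator 3) = (surfaceRelator 3)⁻¹ ∧
      (∀ p, θ (FreeGroup.of p) ∈ normalClosure ({FreeGroup.of p} : Set (FreeGroup (surfaceGen 3)))) ∧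
      (∀ p, θ.symm (FreeGroup.of p) ∈ normalClosure ({FreeGroup.of p} : Set (FreeGroup (surfaceGen 3)))) := by
  -- the conjugators `vⱼ`
  let c : Fin 3 → FreeGroup (surfaceGen 3) := fun j => genA j * genB j * (genA j)⁻¹ * (genB j)⁻¹
  let v : Fin 3 → FreeGroup (surfaceGen 3) := ![(c 2)⁻¹ * (c 1)⁻¹, (c 2)⁻¹, 1]
  let f : surfaceGen 3 → FreeGroup (surfaceGen 3) := fun p =>
    if p.2 then (v p.1 * genA p.1) * genB p.1 * (v p.1 * genA p.1)⁻¹ else v p.1 * (genA p.1)⁻¹ * (v p.1)⁻¹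
  let θ₀ : FreeGroup (surfaceGen 3) →* FreeGroup (surfaceGen 3) := FreeGroup.lift f
  have hθ₀ : ∀ p, θ₀ (FreeGroup.of p) = f p := fun p => FreeGroup.lift_apply_of
  -- involution
  have hinv : θ₀.comp θ₀ = MonoidHom.id _ := by
    refine FreeGroup.ext_hom _ _ fun p => ?_
    obtain ⟨j, b⟩ := p
    fin_cases j <;> cases b <;>
      simp [θ₀, f, v, c, genA, genB] <;> group
  have hmem : ∀ p, θ₀ (FreeGroup.of p) ∈
      normalClosure ({FreeGroup.of p} : Set (FreeGroup (surfaceGen 3))) := by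
    rintro ⟨j, b⟩
    rw [hθ₀]
    cases b
    · simp only [f, Bool.false_eq_true, if_false]
      exact Subgroup.normalClosure_normal.conj_mem _
        (inv_mem (subset_normalClosure (Set.mem_singleton _))) _
    · simp only [f, if_true]
      exact Subgroup.normalClosure_normal.conj_mem _ (subset_normalClosure (Set.mem_singleton _)) _
  have hrel : θ₀ (surfaceRelator 3) = (surfaceRelator 3)⁻¹ := by
    simp [θ₀, f, v, c, surfaceRelator, genA, genB, List.finRange_succ]
    group
  refine ⟨MonoidHom.toMulEquiv θ₀ θ₀ hinv hinv, hrel, hrel, hmem, hmem⟩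

end Flip


/-! ### The `S⁴` side: conjugation-like endomorphisms preserve the lifted `S⁴` kernels -/

section SphereSide

/-- An endomorphism `τ` of `F⟨a₁, …, b₃⟩` which kills the surface relator modulo `⟪r₃⟫` and sends
every generator into the normal closure of that generator (e.g. to a conjugate of its inverse)
preserves the preimage in the free group of each `S⁴` kernel `⟪a₁,a₂,b₃⟫, ⟪a₁,b₂,a₃⟫, ⟪b₁,a₂,a₃⟫`
of `S_3`. [folklore] -/
theorem mk_apply_mem_s4Kernels (τ : FreeGroup (surfaceGen 3) →* FreeGroup (surfaceGen 3))
    (hr : τ (surfaceRelator 3) ∈ normalClosure ({surfaceRelator 3} : Set (FreeGroup (surfaceGen 3))))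
    (hgen : ∀ p, τ (FreeGroup.of p) ∈
      normalClosure ({FreeGroup.of p} : Set (FreeGroup (surfaceGen 3))))
    (i : Fin 3) {y : FreeGroup (surfaceGen 3)}
    (hy : PresentedGroup.mk ({surfaceRelator 3} : Set (FreeGroup (surfaceGen 3))) y ∈ s4Kernels i) :
    PresentedGroup.mk ({surfaceRelator 3} : Set (FreeGroup (surfaceGen 3))) (τ y) ∈ s4Kernels i := by
  haveI : (s4Kernels i).Normal := by rw [s4Kernels_eq]; infer_instance
  set mk₃ := PresentedGroup.mk ({surfaceRelator 3} : Set (FreeGroup (surfaceGen 3))) with hmk₃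
  have hG : (PresentedGroup.of '' (s4Gens i : Set (surfaceGen 3)) : Set (SurfaceGroup 3)) =
      mk₃ '' (FreeGroup.of '' (s4Gens i : Set (surfaceGen 3))) := by
    rw [Set.image_image]
    rfl
  have h1 : (s4Kernels i).comap mk₃ =
      normalClosure (FreeGroup.of '' (s4Gens i : Set (surfaceGen 3))) ⊔ mk₃.ker := by
    rw [← Subgroup.comap_map_eq, map_normalClosure _ _ (PresentedGroup.mk_surjective _), ← hG,
      ← s4Kernels_eq]
  have key : (s4Kernels i).comap mk₃ ≤ (s4Kernels i).comap (mk₃.comp τ) := by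
    rw [h1, sup_le_iff]
    constructor
    · refine normalClosure_le_normal ?_
      rintro _ ⟨p, hp, rfl⟩
      rw [SetLike.mem_coe, Subgroup.mem_comap, MonoidHom.comp_apply]
      have h2 : mk₃ (τ (FreeGroup.of p)) ∈ normalClosure (mk₃ '' {FreeGroup.of p}) :=
        map_normalClosure_le _ mk₃ ⟨_, hgen p, rfl⟩
      rw [Set.image_singleton] at h2
      refine normalClosure_le_normal ?_ h2
      intro z hz
      rw [Set.mem_singleton_iff] at hz
      rw [hz]
      exact of_mem_s4Kernels i hp
    · rw [ker_presentedGroup_mk_surface]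
      refine normalClosure_le_normal ?_
      intro z hz
      rw [Set.mem_singleton_iff] at hz
      rw [hz, SetLike.mem_coe, Subgroup.mem_comap, MonoidHom.comp_apply,
        PresentedGroup.mk_eq_one_iff.2 hr]
      exact one_mem _
  exact key hy

end SphereSide

/-! ### Inner automorphisms do not change the stabilisation -/

section Conj

variable {g : ℕ}

/-- **Inner automorphisms of `S_g` do not change the stabilised kernel triple**: replacing each
`Kᵢ` by `d Kᵢ d⁻¹` replaces the first half of the generating set of `stabilize K i` by a conjugate,
which has the same normal closure (in the source: the connected sum of group trisections is well
defined on isomorphism classes, Abrams–Gay–Kirby Def. 2). [cite: AbramsGayKirby2018, Def. 2–3 (pp. 1539–1540)] -/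
theorem TrisectionKernels.stabilize_map_conj (K : TrisectionKernels g) (d : SurfaceGroup g) :
    TrisectionKernels.stabilize (fun i => (K i).map (MulAut.conj d).toMonoidHom) = K.stabilize := by
  obtain ⟨d, rfl⟩ := PresentedGroup.mk_surjective _ d
  funext i
  rw [TrisectionKernels.stabilize_apply, TrisectionKernels.stabilize_apply]
  set D : SurfaceGroup (g + 3) := PresentedGroup.mk _ (genIncl g d) with hD
  apply le_antisymm
  · refine normalClosure_le_normal ?_
    rintro _ (⟨x, hx, rfl⟩ | ⟨y, hy, rfl⟩)
    · have hx' : d⁻¹ * x * d ∈ (PresentedGroup.mk _) ⁻¹' (K i : Set (SurfaceGroup g)) := by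
        rw [Set.mem_preimage, SetLike.mem_coe, Subgroup.mem_map_equiv, MulAut.conj_symm_apply] at hx
        rw [Set.mem_preimage, SetLike.mem_coe, map_mul, map_mul, map_inv]
        exact hx
      have hconj : (PresentedGroup.mk _ (genIncl g x) : SurfaceGroup (g + 3)) =
          D * PresentedGroup.mk _ (genIncl g (d⁻¹ * x * d)) * D⁻¹ := by
        simp only [hD, map_mul, map_inv]
        group
      rw [SetLike.mem_coe, Function.comp_apply, hconj]
      exact Subgroup.normalClosure_normal.conj_mem _
        (subset_normalClosure (Set.mem_union_left _
          (Set.mem_image_of_mem (PresentedGroup.mk _ ∘ genIncl g) hx'))) D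
    · exact subset_normalClosure (Set.mem_union_right _ (Set.mem_image_of_mem _ hy))
  · refine normalClosure_le_normal ?_
    rintro _ (⟨x, hx, rfl⟩ | ⟨y, hy, rfl⟩)
    · have hx' : d * x * d⁻¹ ∈ (PresentedGroup.mk _) ⁻¹'
          ((K i).map (MulAut.conj (PresentedGroup.mk _ d)).toMonoidHom : Set (SurfaceGroup g)) := by
        rw [Set.mem_preimage, SetLike.mem_coe, Subgroup.mem_map_equiv, MulAut.conj_symm_apply,
          map_mul, map_mul, map_inv]
        have h' : ((PresentedGroup.mk _ d : SurfaceGroup g))⁻¹ * (PresentedGroup.mk _ d *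
            PresentedGroup.mk _ x * (PresentedGroup.mk _ d)⁻¹) * PresentedGroup.mk _ d =
            (PresentedGroup.mk _ x : SurfaceGroup g) := by
          group
        rw [h']
        exact hx
      have hconj : (PresentedGroup.mk _ (genIncl g x) : SurfaceGroup (g + 3)) =
          D⁻¹ * PresentedGroup.mk _ (genIncl g (d * x * d⁻¹)) * D⁻¹⁻¹ := by
        simp only [hD, map_mul, map_inv]
        group
      rw [SetLike.mem_coe, Function.comp_apply, hconj]
      exact Subgroup.normalClosure_normal.conj_mem _
        (subset_normalClosure (Set.mem_union_left _
          (Set.mem_image_of_mem (PresentedGroup.mk _ ∘ genIncl g) hx'))) D⁻¹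
    · exact subset_normalClosure (Set.mem_union_right _ (Set.mem_image_of_mem _ hy))

end Conj

/-! ### Isomorphism invariance of the stabilisation under liftable automorphisms -/

section Main

variable {g : ℕ}

/-- The case `φ(r_g) = r_g^{±1}` of `TrisectionKernels.iso_stabilize_map_of_lift`, with the
automorphism `τ` used on the three new handles (`τ = id` or the flip) as a parameter. [folklore] -/
theorem TrisectionKernels.iso_stabilize_map_of_lift_aux (K : TrisectionKernels g)
    (α : SurfaceGroup g ≃* SurfaceGroup g) (φ : FreeGroup (surfaceGen g) ≃* FreeGroup (surfaceGen g))
    {ε : ℤ} (hε : ε = 1 ∨ ε = -1) (hφr : φ (surfaceRelator g) = surfaceRelator g ^ ε)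
    (hφα : ∀ x, PresentedGroup.mk _ (φ x) = α (PresentedGroup.mk _ x))
    (τ : FreeGroup (surfaceGen 3) ≃* FreeGroup (surfaceGen 3))
    (hτr : τ (surfaceRelator 3) = surfaceRelator 3 ^ ε)
    (hτr' : τ.symm (surfaceRelator 3) ∈
      normalClosure ({surfaceRelator 3} : Set (FreeGroup (surfaceGen 3))))
    (hτ : ∀ p, τ (FreeGroup.of p) ∈ normalClosure ({FreeGroup.of p} : Set (FreeGroup (surfaceGen 3))))
    (hτ' : ∀ p, τ.symm (FreeGroup.of p) ∈
      normalClosure ({FreeGroup.of p} : Set (FreeGroup (surfaceGen 3)))) :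
    TrisectionKernels.Iso K.stabilize
      (TrisectionKernels.stabilize fun i => (K i).map α.toMonoidHom) := by
  obtain ⟨E, hE₁, hE₂⟩ := exists_freeGroup_mulEquiv_extension φ τ
  have hE₁x : ∀ x, E (genIncl g x) = genIncl g (φ x) := fun x => by
    simpa using DFunLike.congr_fun hE₁ x
  have hE₂y : ∀ y, E (genShift g y) = genShift g (τ y) := fun y => by
    simpa using DFunLike.congr_fun hE₂ y
  have hEr : E (surfaceRelator (g + 3)) =
      genIncl g (surfaceRelator g ^ ε) * genShift g (surfaceRelator 3 ^ ε) := by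
    rw [← hφr, ← hτr]
    simpa using freeGroup_extension_surfaceRelator hE₁ hE₂
  have hN : normalClosure ({E (surfaceRelator (g + 3))} : Set (FreeGroup (surfaceGen (g + 3)))) =
      normalClosure {surfaceRelator (g + 3)} := by
    rcases hε with rfl | rfl
    · rw [hEr, zpow_one, zpow_one, ← surfaceRelator_add_three g]
    · refine normalClosure_singleton_eq_of_eq_conj_zpow (c := (genIncl g (surfaceRelator g))⁻¹)
        (Or.inr rfl) ?_
      rw [hEr, surfaceRelator_add_three g, map_zpow, map_zpow]
      group
  obtain ⟨β, hβ⟩ := exists_surfaceGroup_mulEquiv_of_free E hN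
  have hτr₁ : τ (surfaceRelator 3) ∈
      normalClosure ({surfaceRelator 3} : Set (FreeGroup (surfaceGen 3))) := by
    rw [hτr]
    exact zpow_mem (subset_normalClosure (Set.mem_singleton _)) ε
  refine ⟨β, fun i => ?_⟩
  rw [TrisectionKernels.stabilize_apply, TrisectionKernels.stabilize_apply,
    map_normalClosure _ _ β.surjective]
  congr 1
  ext z
  constructor
  · rintro ⟨w, (⟨x, hx, rfl⟩ | ⟨y, hy, rfl⟩), rfl⟩
    · refine Or.inl ⟨φ x, ?_, ?_⟩
      · rw [Set.mem_preimage, SetLike.mem_coe, hφα, Subgroup.mem_map_equiv, MulEquiv.symm_apply_apply]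
        exact hx
      · simp only [Function.comp_apply, MulEquiv.coe_toMonoidHom, hβ, hE₁x]
    · refine Or.inr ⟨τ y, mk_apply_mem_s4Kernels τ.toMonoidHom hτr₁ hτ i hy, ?_⟩
      simp only [Function.comp_apply, MulEquiv.coe_toMonoidHom, hβ, hE₂y]
  · rintro (⟨x, hx, rfl⟩ | ⟨y, hy, rfl⟩)
    · refine ⟨PresentedGroup.mk _ (genIncl g (φ.symm x)), Or.inl ⟨φ.symm x, ?_, rfl⟩, ?_⟩
      · rw [Set.mem_preimage, SetLike.mem_coe, Subgroup.mem_map_equiv] at hx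
        rw [Set.mem_preimage, SetLike.mem_coe]
        have h := hφα (φ.symm x)
        rw [MulEquiv.apply_symm_apply] at h
        rw [← α.symm_apply_apply (PresentedGroup.mk _ (φ.symm x)), ← h]
        exact hx
      · simp only [Function.comp_apply, MulEquiv.coe_toMonoidHom, hβ, hE₁x, MulEquiv.apply_symm_apply]
    · refine ⟨PresentedGroup.mk _ (genShift g (τ.symm y)),
        Or.inr ⟨τ.symm y, mk_apply_mem_s4Kernels τ.symm.toMonoidHom hτr' hτ' i hy, rfl⟩, ?_⟩
      simp only [Function.comp_apply, MulEquiv.coe_toMonoidHom, hβ, hE₂y, MulEquiv.apply_symm_apply]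

/-- **Isomorphism invariance of the algebraic stabilisation under liftable automorphisms.**  If
an automorphism `α` of the surface group `S_g` is induced by an automorphism `φ` of the free group
`F⟨a₁, b₁, …, a_g, b_g⟩` sending the surface relator `r_g = ∏ [aᵢ, bᵢ]` to a conjugate of
`r_g^{±1}`, then the stabilisation of the kernel triple `(α Kᵢ)ᵢ` is isomorphic to the
stabilisation of `(Kᵢ)ᵢ`; the isomorphism of `S_{g+3}` is induced by `φ` on the first `g` handles
and by the identity, resp. an orientation flip (`exists_flip_freeGroup_three`), on the three new
handles.  By Nielsen's theorem (every automorphism of `S_g` is induced by an automorphism of the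
free group; Lyndon–Schupp, Ch. I §4 and Ch. II §2) and Magnus' conjugacy theorem (Lyndon–Schupp,
Prop. II.5.8) *every* `α` is liftable in this sense, so this is the algebraic content of "the
stabilisation of a group trisection is well defined on isomorphism classes" (Abrams–Gay–Kirby,
Def. 3 and Thm. 5); the lifting theorems themselves are not proved here.
[cite: AbramsGayKirby2018, Def. 3 (p. 1540) and Thm. 5 (p. 1541)] -/
theorem TrisectionKernels.iso_stabilize_map_of_lift (K : TrisectionKernels g)
    (α : SurfaceGroup g ≃* SurfaceGroup g)
    (hα : ∃ (φ : FreeGroup (surfaceGen g) ≃* FreeGroup (surfaceGen g)) (c : FreeGroup (surfaceGen g))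
      (ε : ℤ), (ε = 1 ∨ ε = -1) ∧ φ (surfaceRelator g) = c * surfaceRelator g ^ ε * c⁻¹ ∧
      ∀ x, PresentedGroup.mk _ (φ x) = α (PresentedGroup.mk _ x)) :
    TrisectionKernels.Iso K.stabilize
      (TrisectionKernels.stabilize fun i => (K i).map α.toMonoidHom) := by
  obtain ⟨φ, c, ε, hε, hφr, hφα⟩ := hα
  -- conjugate the conjugator away: `φ' = conj(c⁻¹) ∘ φ` lifts `α' = conj([c]⁻¹) ∘ α`
  let φ' : FreeGroup (surfaceGen g) ≃* FreeGroup (surfaceGen g) := φ.trans (MulAut.conj c⁻¹)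
  let α' : SurfaceGroup g ≃* SurfaceGroup g :=
    α.trans (MulAut.conj (PresentedGroup.mk ({surfaceRelator g} : Set _) c)⁻¹)
  have hφ'r : φ' (surfaceRelator g) = surfaceRelator g ^ ε := by
    simp only [φ', MulEquiv.trans_apply, MulAut.conj_apply, hφr, inv_inv]
    group
  have hφ'α : ∀ x, PresentedGroup.mk _ (φ' x) = α' (PresentedGroup.mk _ x) := fun x => by
    show PresentedGroup.mk _ (c⁻¹ * φ x * c⁻¹⁻¹) =
      (PresentedGroup.mk _ c)⁻¹ * α (PresentedGroup.mk _ x) * (PresentedGroup.mk _ c)⁻¹⁻¹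
    simp only [map_mul, map_inv, hφα]
  have hK : TrisectionKernels.stabilize (fun i => (K i).map α'.toMonoidHom) =
      TrisectionKernels.stabilize (fun i => (K i).map α.toMonoidHom) := by
    have : (fun i => (K i).map α'.toMonoidHom : TrisectionKernels g) = fun i =>
        ((K i).map α.toMonoidHom).map
          (MulAut.conj (PresentedGroup.mk ({surfaceRelator g} : Set _) c)⁻¹).toMonoidHom := by
      funext i
      rw [Subgroup.map_map]
      rfl
    rw [this, TrisectionKernels.stabilize_map_conj]
  rw [← hK]
  rcases hε with rfl | rfl
  · exact TrisectionKernels.iso_stabilize_map_of_lift_aux K α' φ' (Or.inl rfl) hφ'r hφ'α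
      (MulEquiv.refl _) (by simp) (by simpa using subset_normalClosure (Set.mem_singleton _))
      (fun p => subset_normalClosure (Set.mem_singleton _))
      (fun p => subset_normalClosure (Set.mem_singleton _))
  · obtain ⟨θ, hθr, hθr', hθ, hθ'⟩ := exists_flip_freeGroup_three
    exact TrisectionKernels.iso_stabilize_map_of_lift_aux K α' φ' (Or.inr rfl) hφ'r hφ'α θ
      (by rw [hθr, zpow_neg_one])
      (by rw [hθr']; exact inv_mem (subset_normalClosure (Set.mem_singleton _))) hθ hθ'

/-- `Iso` form of `TrisectionKernels.iso_stabilize_map_of_lift`: an isomorphism of kernel triples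
witnessed by a liftable automorphism of `S_g` stabilises to an isomorphism of the stabilised
triples (Abrams–Gay–Kirby, Def. 3: stabilisation is an operation on isomorphism classes of group
trisections). [cite: AbramsGayKirby2018, Def. 3 (p. 1540)] -/
theorem TrisectionKernels.Iso.stabilize_of_lift {K K' : TrisectionKernels g}
    (h : ∃ α : SurfaceGroup g ≃* SurfaceGroup g,
      (∃ (φ : FreeGroup (surfaceGen g) ≃* FreeGroup (surfaceGen g)) (c : FreeGroup (surfaceGen g))
        (ε : ℤ), (ε = 1 ∨ ε = -1) ∧ φ (surfaceRelator g) = c * surfaceRelator g ^ ε * c⁻¹ ∧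
        ∀ x, PresentedGroup.mk _ (φ x) = α (PresentedGroup.mk _ x)) ∧
      ∀ i, (K i).map α.toMonoidHom = K' i) :
    TrisectionKernels.Iso K.stabilize K'.stabilize := by
  obtain ⟨α, hα, hK⟩ := h
  obtain rfl : K' = fun i => (K i).map α.toMonoidHom := funext fun i => (hK i).symm
  exact TrisectionKernels.iso_stabilize_map_of_lift K α hα

end Main


/-! ### Liftable automorphisms form a subgroup of `Aut S_g` containing the inner automorphisms

"`α` is liftable" abbreviates the hypothesis of `TrisectionKernels.iso_stabilize_map_of_lift`:
`∃ φ c ε, (ε = 1 ∨ ε = -1) ∧ φ r_g = c · r_g^ε · c⁻¹ ∧ ∀ x, [φ x] = α [x]` with `φ` an automorphism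
of the free group.  Nielsen's theorem says that every automorphism of `S_g` is liftable; the
closure properties below reduce such a statement to generators of `Aut S_g`. -/

section Liftable

variable {g : ℕ}

/-- The identity of `S_g` is liftable (by the identity of the free group). [folklore] -/
theorem liftable_refl (g : ℕ) :
    ∃ (φ : FreeGroup (surfaceGen g) ≃* FreeGroup (surfaceGen g)) (c : FreeGroup (surfaceGen g))
      (ε : ℤ), (ε = 1 ∨ ε = -1) ∧ φ (surfaceRelator g) = c * surfaceRelator g ^ ε * c⁻¹ ∧
      ∀ x, PresentedGroup.mk _ (φ x) = MulEquiv.refl (SurfaceGroup g) (PresentedGroup.mk _ x) :=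
  ⟨MulEquiv.refl _, 1, 1, Or.inl rfl, by simp, fun _ => rfl⟩

/-- Inner automorphisms of `S_g` are liftable (by inner automorphisms of the free group). [folklore] -/
theorem liftable_conj (d : SurfaceGroup g) :
    ∃ (φ : FreeGroup (surfaceGen g) ≃* FreeGroup (surfaceGen g)) (c : FreeGroup (surfaceGen g))
      (ε : ℤ), (ε = 1 ∨ ε = -1) ∧ φ (surfaceRelator g) = c * surfaceRelator g ^ ε * c⁻¹ ∧
      ∀ x, PresentedGroup.mk _ (φ x) = MulAut.conj d (PresentedGroup.mk _ x) := by
  obtain ⟨d, rfl⟩ := PresentedGroup.mk_surjective _ d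
  refine ⟨MulAut.conj d, d, 1, Or.inl rfl, by simp, fun x => ?_⟩
  simp only [MulAut.conj_apply, map_mul, map_inv]

/-- Liftable automorphisms are closed under composition. [folklore] -/
theorem liftable_trans {α β : SurfaceGroup g ≃* SurfaceGroup g}
    (hα : ∃ (φ : FreeGroup (surfaceGen g) ≃* FreeGroup (surfaceGen g)) (c : FreeGroup (surfaceGen g))
      (ε : ℤ), (ε = 1 ∨ ε = -1) ∧ φ (surfaceRelator g) = c * surfaceRelator g ^ ε * c⁻¹ ∧
      ∀ x, PresentedGroup.mk _ (φ x) = α (PresentedGroup.mk _ x))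
    (hβ : ∃ (φ : FreeGroup (surfaceGen g) ≃* FreeGroup (surfaceGen g)) (c : FreeGroup (surfaceGen g))
      (ε : ℤ), (ε = 1 ∨ ε = -1) ∧ φ (surfaceRelator g) = c * surfaceRelator g ^ ε * c⁻¹ ∧
      ∀ x, PresentedGroup.mk _ (φ x) = β (PresentedGroup.mk _ x)) :
    ∃ (φ : FreeGroup (surfaceGen g) ≃* FreeGroup (surfaceGen g)) (c : FreeGroup (surfaceGen g))
      (ε : ℤ), (ε = 1 ∨ ε = -1) ∧ φ (surfaceRelator g) = c * surfaceRelator g ^ ε * c⁻¹ ∧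
      ∀ x, PresentedGroup.mk _ (φ x) = (α.trans β) (PresentedGroup.mk _ x) := by
  obtain ⟨φ, c, ε, hε, hφr, hφ⟩ := hα
  obtain ⟨ψ, d, η, hη, hψr, hψ⟩ := hβ
  refine ⟨φ.trans ψ, ψ c * d, ε * η, ?_, ?_, fun x => ?_⟩
  · rcases hε with rfl | rfl <;> rcases hη with rfl | rfl <;> simp
  · rw [MulEquiv.trans_apply, hφr, map_mul, map_mul, map_inv, map_zpow, hψr]
    rcases hε with rfl | rfl <;> rcases hη with rfl | rfl <;> group
  · rw [MulEquiv.trans_apply, MulEquiv.trans_apply, hψ, hφ]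

/-- Liftable automorphisms are closed under inversion. [folklore] -/
theorem liftable_symm {α : SurfaceGroup g ≃* SurfaceGroup g}
    (hα : ∃ (φ : FreeGroup (surfaceGen g) ≃* FreeGroup (surfaceGen g)) (c : FreeGroup (surfaceGen g))
      (ε : ℤ), (ε = 1 ∨ ε = -1) ∧ φ (surfaceRelator g) = c * surfaceRelator g ^ ε * c⁻¹ ∧
      ∀ x, PresentedGroup.mk _ (φ x) = α (PresentedGroup.mk _ x)) :
    ∃ (φ : FreeGroup (surfaceGen g) ≃* FreeGroup (surfaceGen g)) (c : FreeGroup (surfaceGen g))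
      (ε : ℤ), (ε = 1 ∨ ε = -1) ∧ φ (surfaceRelator g) = c * surfaceRelator g ^ ε * c⁻¹ ∧
      ∀ x, PresentedGroup.mk _ (φ x) = α.symm (PresentedGroup.mk _ x) := by
  obtain ⟨φ, c, ε, hε, hφr, hφ⟩ := hα
  have key : ∀ y d r : FreeGroup (surfaceGen g), r = d * y ^ ε * d⁻¹ → y = d⁻¹ * r ^ ε * d⁻¹⁻¹ := by
    rintro y d r rfl
    rcases hε with rfl | rfl <;> group
  refine ⟨φ.symm, φ.symm c⁻¹, ε, hε, ?_, fun x => ?_⟩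
  · rw [map_inv]
    apply key
    have h := congrArg φ.symm hφr
    rwa [MulEquiv.symm_apply_apply, map_mul, map_inv, map_mul, map_zpow] at h
  · rw [eq_comm, MulEquiv.symm_apply_eq, ← hφ, MulEquiv.apply_symm_apply]

end Liftable

/-! ### The glue with the geometric side -/

section Glue

variable {X : Type u} [TopologicalSpace X] [ChartedSpace (EuclideanSpace ℝ (Fin 4)) X]

/-- Two markings of the same central surface at the same base point give kernel triples which
differ by the automorphism `μ⁻¹ ∘ μ₀` of `S_g` *on the nose*:
`𝒢(h, x₀, μ) = (μ⁻¹ μ₀)(𝒢(h, x₀, μ₀))` (sharpening `groupGKTrisectionOf_iso_of_markings`).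
[cite: AbramsGayKirby2018, Def. 1 (p. 1538, isomorphism of trisections)] -/
theorem groupGKTrisectionOf_eq_map_of_markings {g : ℕ} {k : Fin 3 → ℕ} {S : Fin 3 → Set X}
    (h : IsGKTrisection X g k S) (x₀ : centralSurface S)
    (μ₀ μ : SurfaceGroup g ≃* FundamentalGroup (centralSurface S) x₀) :
    groupGKTrisectionOf h x₀ μ =
      fun i => (groupGKTrisectionOf h x₀ μ₀ i).map (μ₀.trans μ.symm).toMonoidHom := by
  funext i
  ext γ
  rw [Subgroup.mem_map_equiv, mem_groupGKTrisectionOf_iff, mem_groupGKTrisectionOf_iff,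
    MulEquiv.symm_trans_apply, MulEquiv.symm_symm, MulEquiv.apply_symm_apply]

/-- **(c′) for one marked trisection, from its geometric stabilisation and a Nielsen lift.**  Let
`S` be a balanced Gay–Kirby `(g, k)`-trisection of `X` with base point `x₀` on the central
surface.  Suppose (geometric input: Gay–Kirby's Lemma 10 / Abrams–Gay–Kirby's Thm. 5 for this
trisection, read through SOME marking `μ₀`) that `X` carries a balanced `(g+3, k+1)`-trisection
with a marking whose kernel triple is isomorphic to the algebraic stabilisation of
`𝒢(h, x₀, μ₀)`, and (algebraic input: Nielsen's lifting property for the single automorphism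
`μ⁻¹ ∘ μ₀` of `S_g`) that `μ⁻¹ ∘ μ₀` is induced by a free automorphism sending `r_g` to a conjugate
of `r_g^{±1}`.  Then the conclusion of (c′) holds for the marking `μ`: the same stabilised
trisection has kernel triple isomorphic to the stabilisation of `𝒢(h, x₀, μ)`
(`TrisectionKernels.iso_stabilize_map_of_lift`).  No hypothesis on `X` beyond a charted space is
needed for this step. [cite: AbramsGayKirby2018, Def. 3 (p. 1540) and Thm. 5 (p. 1541)] -/
theorem exists_stabilized_gkTrisection_of_lift {g k : ℕ} {S : Fin 3 → Set X}
    (h : IsBalancedGKTrisection X g k S) (x₀ : centralSurface S)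
    (μ₀ μ : SurfaceGroup g ≃* FundamentalGroup (centralSurface S) x₀)
    (hgeom : ∃ (S' : Fin 3 → Set X) (h' : IsBalancedGKTrisection X (g + 3) (k + 1) S')
      (x₀' : centralSurface S')
      (μ' : SurfaceGroup (g + 3) ≃* FundamentalGroup (centralSurface S') x₀'),
      TrisectionKernels.Iso (groupGKTrisectionOf h' x₀' μ') (groupGKTrisectionOf h x₀ μ₀).stabilize)
    (hlift : ∃ (φ : FreeGroup (surfaceGen g) ≃* FreeGroup (surfaceGen g)) (c : FreeGroup (surfaceGen g))
      (ε : ℤ), (ε = 1 ∨ ε = -1) ∧ φ (surfaceRelator g) = c * surfaceRelator g ^ ε * c⁻¹ ∧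
      ∀ x, PresentedGroup.mk _ (φ x) = (μ₀.trans μ.symm) (PresentedGroup.mk _ x)) :
    ∃ (S' : Fin 3 → Set X) (h' : IsBalancedGKTrisection X (g + 3) (k + 1) S')
      (x₀' : centralSurface S')
      (μ' : SurfaceGroup (g + 3) ≃* FundamentalGroup (centralSurface S') x₀'),
      TrisectionKernels.Iso (groupGKTrisectionOf h' x₀' μ') (groupGKTrisectionOf h x₀ μ).stabilize := by
  obtain ⟨S', h', x₀', μ', hiso⟩ := hgeom
  refine ⟨S', h', x₀', μ', hiso.trans ?_⟩
  rw [groupGKTrisectionOf_eq_map_of_markings h x₀ μ₀ μ]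
  exact TrisectionKernels.iso_stabilize_map_of_lift _ _ hlift

/-- **The shape of a future discharge of (c′).**  Fact (c′)
`Literature.Topology.FourManifolds.exists_stabilized_gkTrisection` follows from
(1) the GEOMETRIC stabilisation — for every balanced Gay–Kirby trisection of a closed connected
oriented smooth `X` and every base point on the central surface, a balanced `(g+3, k+1)`-trisection
of `X` whose kernel triple is isomorphic to the algebraic stabilisation of the original one for
SOME marking `μ₀` (Gay–Kirby 2016, Def. 8 and Lemma 10: "`(X₁′, X₂′, X₃′)` is also a trisection of
`X`, with genus `g′ = g + 3`", whose diagram is the connected sum with the genus-`3` diagram of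
`S⁴`; Abrams–Gay–Kirby 2018, Thm. 5: "connected sums of group trisections map to connected sums of
4-manifold trisections") — together with
(2) NIELSEN'S THEOREM in the form "every automorphism of `S_g = ⟨a₁, …, b_g ∣ ∏[aᵢ,bᵢ]⟩` is
induced by an automorphism of the free group `F⟨a₁, …, b_g⟩`" (Lyndon–Schupp, Ch. I §4, last
remark, and Ch. II §2; Nielsen 1927), the inducing automorphism then sending the relator to a
conjugate of its inverse or itself by Magnus' theorem (Lyndon–Schupp, Prop. II.5.8).
Neither (1) nor (2) is proved in the tree; both enter as hypotheses, and (c′) stays a named fact.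
[cite: AbramsGayKirby2018, Def. 3 (p. 1540) and Thm. 5 (p. 1541)]
[cite: LyndonSchupp2001, Ch. I §4 (Nielsen) and Prop. II.5.8 (Magnus)] -/
theorem exists_stabilized_gkTrisection_of_geometric_of_nielsen
    (hgeom : ∀ (X : Type u) [TopologicalSpace X] [T2Space X] [SecondCountableTopology X]
      [ChartedSpace (EuclideanSpace ℝ (Fin 4)) X] [IsManifold (𝓡 4) ∞ X] [CompactSpace X]
      [ConnectedSpace X] (_ : SmoothOrientation (𝓡 4) X) (g k : ℕ) (S : Fin 3 → Set X)
      (h : IsBalancedGKTrisection X g k S) (x₀ : centralSurface S),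
      ∃ (μ₀ : SurfaceGroup g ≃* FundamentalGroup (centralSurface S) x₀) (S' : Fin 3 → Set X)
        (h' : IsBalancedGKTrisection X (g + 3) (k + 1) S') (x₀' : centralSurface S')
        (μ' : SurfaceGroup (g + 3) ≃* FundamentalGroup (centralSurface S') x₀'),
        TrisectionKernels.Iso (groupGKTrisectionOf h' x₀' μ')
          (groupGKTrisectionOf h x₀ μ₀).stabilize)
    (hN : ∀ (g : ℕ) (α : SurfaceGroup g ≃* SurfaceGroup g),
      ∃ (φ : FreeGroup (surfaceGen g) ≃* FreeGroup (surfaceGen g)) (c : FreeGroup (surfaceGen g))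
        (ε : ℤ), (ε = 1 ∨ ε = -1) ∧ φ (surfaceRelator g) = c * surfaceRelator g ^ ε * c⁻¹ ∧
        ∀ x, PresentedGroup.mk _ (φ x) = α (PresentedGroup.mk _ x)) :
    exists_stabilized_gkTrisection.{u} := by
  intro X _ _ _ _ _ _ _ o g k S h x₀ μ
  obtain ⟨μ₀, hgeom'⟩ := hgeom X o g k S h x₀
  exact exists_stabilized_gkTrisection_of_lift h x₀ μ₀ μ hgeom' (hN g _)

end Glue

end Literature.Topology.FourManifolds
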